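import Summits.QuantumFields.BalabanUV.Beta.GAN24.DirichletVertexLocalVertex

/-!
# `BalabanUV.Beta.GAN24.DirichletVertexLocalSums` — binder row G-an2-4 / (CONV-C), road P2 PART IV, leaf L14 (the torus transfer), FILE U4:
# THE VERTEX FAMILIES WITH WINDOW-LOCAL CURRENCIES — binder (B) and the dyadic Hessian family with `|V|` replaced by `4`
# (unit b2b-balaban-gan24-p2, gen 27, v1)

HONEST FRAMING (cell contract, verbatim): «discharging `BetaPertH` makes Bałaban's UV stability UNCONDITIONAL — a real constructive-QFT
result; it is NOT the continuum limit and NOT the Clay problem.»  SUPPLIER module under the T⁴-DAG sub-row `T4-U1a.S-NE2-D1-DIRICHLET°`.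
`DirichletVertexEnergy.vertex_weighted_energy_le` (p244737) and `DirichletVertexHessian.vertex_weighted_hessian_le` (p244740) bound the
weighted energy / Hessian charged to ONE re-entrant vertex by the GLOBAL budgets `E = ‖∂₀u‖²+‖∂₁u‖²`, `B = Σ_Ω|Δu|²`, so that a family `V`
costs `|V|` (LOCATED L27-1 of memo `gen27/L14-END.md`).  Their proofs pass through the WINDOW-LOCAL currencies `Et (Uc u) (n−1)` (ring
energy of the window) and `sqSum ‖Gc u‖² (n−1)` (window Laplacian); THIS FILE re-exports the two bounds with those currencies as parameters
(`DirichletVertexLocalVertex`); THIS FILE shows the currencies are sub-sums of the STAR BOX sums of `DirichletVertexStarBox` (§2), and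
sums a family with one orientation per vertex by the star-box identity (p247556): `Σ_{v∈V} ≤ 4·(global bound)` — `|V|` becomes `4` (§3).

## Contents ([folklore]; 0 sorry)
* §2 `Et_Uc_le_box : n²·Et (Uc u) (n−1) ≤ boxSum|∂₀u|² + boxSum|∂₁u|²`, `sqSum_Gc_le_box : n⁴·sqSum‖Gc u‖² (n−1) ≤ boxSum(𝟙_Ω|Δu|²)`.
* §3 **`sum_vertex_energy_le`**, **`weighted_energy_le_unif`** ((B) with `|V| ↦ 4`), **`sum_vertex_hessian_le`** (dyadic family with `|V| ↦ 4`).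

ABSOLUTE RULE (cell, verbatim): «No internally-minted statement may enter as a cited fact. Every hypothesis is either kernel-proved in
this package or a verbatim quotation of a PUBLISHED theorem with page reference. The manuscript(s) under audit are NOT citable for
their own disputed steps — they are the thing under adjudication; programme-internal (2001/route/tribunal) claims are never citable.»
Nothing printed is a hypothesis.  NOT CLAIMED: the volume-uniform END (next files); NOT NE2, (CONV-C), `BetaPertH`, continuum, Clay.
«not in print; our proof attempt».  HONEST DEPENDENCY: continuum YM on T⁴ ⇐ BetaPertH ∧ nine spine estimates (0/9 proved); BetaPertH ⇐
(D1) ∧ (D4) ∧ CAP+tail; G-an2-4 gates asym, D1 and NE2/3/4.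
-/

noncomputable section

open scoped BigOperators ComplexConjugate Matrix
open Finset

namespace Summit.QuantumFields.BalabanUV.Beta.GAN24.DirichletVertexLocalSums

open Literature.MathematicalPhysics.QuantumFieldTheory.Balaban1983to89.B5Prop11Plancherel (Tor fine unitVec)
open Literature.MathematicalPhysics.QuantumFieldTheory.Balaban1983to89.B5Action121 (sdiff LapS)
open Literature.MathematicalPhysics.QuantumFieldTheory.Balaban1983to89.B5Prop11Lower (nsq nsq_nonneg)
open Summit.QuantumFields.BalabanUV.Beta.GAN24.DirichletBoxRegularity (Pdir)
open Summit.QuantumFields.BalabanUV.Beta.GAN24.DirichletBoxTrace (blockReg)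
open DirichletRingEnergies (hb vb lap Et sqSum Et_nonneg sqSum_nonneg hb_nonneg vb_nonneg)
open DirichletRingHessianIdentity (d1 d2 offQ)
open DirichletRingHessianWindow (rho nbr)
open DirichletRingLayerCake (wJ)
open DirichletRingSiteWeighted (site_weighted_energy_le)
open DirichletRingHessian (weighted_hessian_le)
open DirichletVertexChart
open DirichletVertexPullback
open DirichletVertexEnergy (invW omegaV inv_omegaV sum_invW_mul one_le_rho nbr_Up_eq bonds_eq_nbr)
open DirichletVertexHessian (hessW sum_hessW_mul offQ_hess_Up_eq)
open DirichletVertexStarBox (boxSum sum_sub_range_le window_le_boxSum sum_family_boxSum_le reentrant_injOn)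
open DirichletVertexLocalVertex (vertex_weighted_energy_le_of vertex_weighted_hessian_le_of)

variable (n : ℕ) [NeZero n] (M : Fin 2 → ℕ) [hM : ∀ μ, NeZero (M μ)]

section Vertex

variable {S : Tor M → Prop} {σ : Fin 2 → Bool} {b : Tor M} {u : Tor (fine n M) → ℂ}

/-! ## §2 The window-local currencies are sub-sums of the star box sums -/

/-- **`n²·Et (Uc u) (n−1) ≤ boxSum |∂₀u|² + boxSum |∂₁u|²`** at a re-entrant vertex. [folklore] -/
theorem Et_Uc_le_box (hu : ∀ x, ¬ blockReg n M S x → u x = 0) (hre : ReentrantAt M S σ b) (hn : 1 ≤ n) :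
    (n : ℝ) ^ 2 * Et (Uc n M σ b u) (n - 1)
      ≤ boxSum n M (fun x => ‖(sdiff (fine n M) (n : ℂ) 0 *ᵥ u) x‖ ^ 2) σ b
        + boxSum n M (fun x => ‖(sdiff (fine n M) (n : ℂ) 1 *ᵥ u) x‖ ^ 2) σ b := by
  set K : ℕ := n - 1 with hK
  have hn0 : (0 : ℝ) < n := by exact_mod_cast hn
  have hn2 : (n : ℝ) ^ 2 ≠ 0 := by positivity
  obtain ⟨hb0, hb1⟩ := bsh_mem σ 0
  obtain ⟨hv0, hv1⟩ := bsh_mem σ 1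
  obtain ⟨a, ha⟩ : ∃ a : ℕ, (a : ℤ) = bsh σ 0 := ⟨(bsh σ 0).toNat, by omega⟩
  obtain ⟨c, hc⟩ : ∃ c : ℕ, (c : ℤ) = bsh σ 1 := ⟨(bsh σ 1).toNat, by omega⟩
  rw [Et_eq_rect, mul_add]
  refine add_le_add ?_ ?_
  · -- horizontal bonds: `hb (Uc) ≤ hb (Up) = ‖∂₀u(emb (i + bsh) j)‖²/n²`, a `(2K+1) × 2K` sub-box shifted by `(bsh, 1)`
    set g : ℕ → ℕ → ℝ := fun s t => ‖(sdiff (fine n M) (n : ℂ) 0 *ᵥ u) (emb n M σ b (-(n : ℤ) + s) (-(n : ℤ) + t))‖ ^ 2 with hg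
    calc (n : ℝ) ^ 2 * EtH (Uc n M σ b u) K
        ≤ (n : ℝ) ^ 2 * EtH (Up n M σ b u) K := by
          refine mul_le_mul_of_nonneg_left ?_ (by positivity)
          unfold EtH
          refine sum_le_sum fun t ht => sum_le_sum fun s hs => ?_
          simp only [mem_range] at ht hs
          exact hb_Uc_le n M hu hre (by omega)
      _ = ∑ t ∈ range (2 * K), ∑ s ∈ range (2 * K + 1), g (s + a) (t + 1) := by
          unfold EtH
          rw [mul_sum]
          refine sum_congr rfl fun t _ => ?_
          rw [mul_sum]
          refine sum_congr rfl fun s _ => ?_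
          rw [hb_Up_eq, mul_div_cancel₀ _ hn2, hg]
          exact DirichletVertexStarBox.F_emb_congr n M (fun x => ‖(sdiff (fine n M) (n : ℂ) 0 *ᵥ u) x‖ ^ 2) σ b
            (by push_cast; omega) (by push_cast; omega)
      _ ≤ _ := sum_sub_range_le g (fun _ _ => sq_nonneg _) (by omega) (by omega)
  · set g : ℕ → ℕ → ℝ := fun s t => ‖(sdiff (fine n M) (n : ℂ) 1 *ᵥ u) (emb n M σ b (-(n : ℤ) + s) (-(n : ℤ) + t))‖ ^ 2 with hg
    calc (n : ℝ) ^ 2 * EtV (Uc n M σ b u) K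
        ≤ (n : ℝ) ^ 2 * EtV (Up n M σ b u) K := by
          refine mul_le_mul_of_nonneg_left ?_ (by positivity)
          unfold EtV
          refine sum_le_sum fun s hs => sum_le_sum fun t ht => ?_
          simp only [mem_range] at ht hs
          exact vb_Uc_le n M hu hre (by omega)
      _ = ∑ s ∈ range (2 * K), ∑ t ∈ range (2 * K + 1), g (s + 1) (t + c) := by
          unfold EtV
          rw [mul_sum]
          refine sum_congr rfl fun s _ => ?_
          rw [mul_sum]
          refine sum_congr rfl fun t _ => ?_
          rw [vb_Up_eq, mul_div_cancel₀ _ hn2, hg]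
          exact DirichletVertexStarBox.F_emb_congr n M (fun x => ‖(sdiff (fine n M) (n : ℂ) 1 *ᵥ u) x‖ ^ 2) σ b
            (by push_cast; omega) (by push_cast; omega)
      _ = ∑ t ∈ range (2 * K + 1), ∑ s ∈ range (2 * K), g (s + 1) (t + c) := sum_comm
      _ ≤ _ := sum_sub_range_le g (fun _ _ => sq_nonneg _) (by omega) (by omega)

/-- **`n⁴·sqSum ‖Gc u‖² (n−1) ≤ boxSum (𝟙_Ω|Δu|²)`** at a re-entrant vertex. [folklore] -/
theorem sqSum_Gc_le_box [DecidablePred S] (hre : ReentrantAt M S σ b) (hn : 1 ≤ n) :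
    (n : ℝ) ^ 4 * sqSum (fun i j => ‖Gc n M σ b u i j‖ ^ 2) (n - 1)
      ≤ boxSum n M (fun x => if blockReg n M S x then ‖(LapS (fine n M) (n : ℂ) *ᵥ u) x‖ ^ 2 else 0) σ b := by
  set K : ℕ := n - 1 with hK
  have hn0 : (0 : ℝ) < n := by exact_mod_cast hn
  have hn4 : (0 : ℝ) < (n : ℝ) ^ 4 := by positivity
  set F : Tor (fine n M) → ℝ := fun x => if blockReg n M S x then ‖(LapS (fine n M) (n : ℂ) *ᵥ u) x‖ ^ 2 else 0 with hF
  have hF0 : ∀ x, 0 ≤ F x := fun x => by rw [hF]; simp only; split_ifs <;> positivity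
  have hterm : ∀ t ∈ range (2 * K), ∀ s ∈ range (2 * K),
      (n : ℝ) ^ 4 * ‖Gc n M σ b u (-(K : ℤ) + s) (-(K : ℤ) + t)‖ ^ 2 ≤ F (emb n M σ b (-(K : ℤ) + s + 0) (-(K : ℤ) + t + 0)) := by
    intro t ht s hs
    simp only [mem_range] at ht hs
    rw [add_zero, add_zero, Gc, hF]
    simp only
    split_ifs with hq hΩ hΩ
    · rw [norm_zero, zero_pow two_ne_zero, mul_zero]; positivity
    · rw [norm_zero, zero_pow two_ne_zero, mul_zero]
    · rw [norm_div, div_pow, norm_pow, Complex.norm_natCast, ← pow_mul, mul_div_cancel₀ _ hn4.ne']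
    · exact absurd (blockReg_emb n M hre (by omega) (by omega) (by omega) (by omega) hq) hΩ
  calc (n : ℝ) ^ 4 * sqSum (fun i j => ‖Gc n M σ b u i j‖ ^ 2) K
      = ∑ t ∈ range (2 * K), ∑ s ∈ range (2 * K), (n : ℝ) ^ 4 * ‖Gc n M σ b u (-(K : ℤ) + s) (-(K : ℤ) + t)‖ ^ 2 := by
        rw [sqSum, mul_sum]; simp only [mul_sum]
    _ ≤ ∑ t ∈ range (2 * K), ∑ s ∈ range (2 * K), F (emb n M σ b (-(K : ℤ) + s + 0) (-(K : ℤ) + t + 0)) :=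
        sum_le_sum fun t ht => sum_le_sum fun s hs => hterm t ht s hs
    _ ≤ boxSum n M F σ b := window_le_boxSum n M hF0 σ b (by omega) (by omega) (by omega) (by omega)

end Vertex

/-! ## §3 The family sums: `|V|` becomes `4` -/

section Family

variable (S : Tor M → Prop) [DecidablePred S] {u : Tor (fine n M) → ℂ}

/-- **THE WEIGHTED ENERGIES OF ALL RE-ENTRANT VERTICES TOGETHER**: for `u` vanishing off `Ω`, a family `V` of re-entrant vertices,
`Σ_{v∈V} Σ_μ Σ_y invW_v|∂_μu|² ≤ 4·(4(1+16/(γ−1))·E + (128π/((γ−1)ε(2−γ)))·B)` — the factor is `4`, not `|V|`. [folklore] -/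
theorem sum_vertex_energy_le (V : Finset ((Fin 2 → Bool) × Tor M)) (hV : ∀ v ∈ V, ReentrantAt M S v.1 v.2)
    (hu : ∀ x, ¬ blockReg n M S x → u x = 0) (hn : 2 ≤ n) {ε : ℝ} (hε : 0 < ε) (hγ : 1 < Real.pi / 3 * (1 - ε / 2)) :
    ∑ v ∈ V, ∑ μ, ∑ y, invW n M v (n - 1) y * ‖(sdiff (fine n M) (n : ℂ) μ *ᵥ u) y‖ ^ 2
      ≤ 4 * (4 * (1 + 16 / (Real.pi / 3 * (1 - ε / 2) - 1))
            * (nsq (sdiff (fine n M) (n : ℂ) 0 *ᵥ u) + nsq (sdiff (fine n M) (n : ℂ) 1 *ᵥ u))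
          + 128 * Real.pi / ((Real.pi / 3 * (1 - ε / 2) - 1) * ε * (2 - Real.pi / 3 * (1 - ε / 2)))
            * ∑ x ∈ univ.filter (blockReg n M S), ‖(LapS (fine n M) (n : ℂ) *ᵥ u) x‖ ^ 2) := by
  have hπ3 := Real.pi_gt_three
  have hε2 : ε < 2 := by
    by_contra h
    have : Real.pi / 3 * (1 - ε / 2) ≤ 0 := mul_nonpos_of_nonneg_of_nonpos (by positivity) (by linarith)
    linarith
  have hγ1 : 0 < Real.pi / 3 * (1 - ε / 2) - 1 := by linarith
  have h2γ : 0 < 2 - Real.pi / 3 * (1 - ε / 2) := by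
    have h1 : Real.pi / 3 * (1 - ε / 2) ≤ Real.pi / 3 * 1 := mul_le_mul_of_nonneg_left (by linarith) (by positivity)
    linarith [Real.pi_lt_four]
  set c₁ : ℝ := 4 * (1 + 16 / (Real.pi / 3 * (1 - ε / 2) - 1)) with hc₁
  set c₂ : ℝ := 128 * Real.pi / ((Real.pi / 3 * (1 - ε / 2) - 1) * ε * (2 - Real.pi / 3 * (1 - ε / 2))) with hc₂
  have hc₁0 : 0 ≤ c₁ := by positivity
  have hc₂0 : 0 ≤ c₂ := by positivity
  set F0 : Tor (fine n M) → ℝ := fun x => ‖(sdiff (fine n M) (n : ℂ) 0 *ᵥ u) x‖ ^ 2 with hF0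
  set F1 : Tor (fine n M) → ℝ := fun x => ‖(sdiff (fine n M) (n : ℂ) 1 *ᵥ u) x‖ ^ 2 with hF1
  set P : Tor (fine n M) → ℝ := fun x => if blockReg n M S x then ‖(LapS (fine n M) (n : ℂ) *ᵥ u) x‖ ^ 2 else 0 with hP
  have hP0 : ∀ x, 0 ≤ P x := fun x => by rw [hP]; simp only; split_ifs <;> positivity
  have hinj := reentrant_injOn M V hV
  -- per vertex, with the local currencies
  have hv : ∀ v ∈ V, ∑ μ, ∑ y, invW n M v (n - 1) y * ‖(sdiff (fine n M) (n : ℂ) μ *ᵥ u) y‖ ^ 2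
      ≤ c₁ * (boxSum n M F0 v.1 v.2 + boxSum n M F1 v.1 v.2) + c₂ * boxSum n M P v.1 v.2 := by
    intro v hvV
    have hE := Et_Uc_le_box n M (σ := v.1) (b := v.2) hu (hV v hvV) (by omega)
    have hB := sqSum_Gc_le_box n M (σ := v.1) (b := v.2) (u := u) (hV v hvV) (by omega)
    have hn0 : (0 : ℝ) < n := by exact_mod_cast (show 0 < n by omega)
    have hbox0 : 0 ≤ boxSum n M F0 v.1 v.2 + boxSum n M F1 v.1 v.2 :=
      add_nonneg (sum_nonneg fun _ _ => sum_nonneg fun _ _ => sq_nonneg _) (sum_nonneg fun _ _ => sum_nonneg fun _ _ => sq_nonneg _)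
    have hboxP : 0 ≤ boxSum n M P v.1 v.2 := sum_nonneg fun _ _ => sum_nonneg fun _ _ => hP0 _
    exact vertex_weighted_energy_le_of n M (σ := v.1) (b := v.2) hu (hV v hvV) hn hε hγ hbox0 hboxP
      (by rw [le_div_iff₀ (by positivity)]; linarith) (by rw [le_div_iff₀ (by positivity)]; linarith)
  have h0 : ∑ v ∈ V, boxSum n M F0 v.1 v.2 ≤ 4 * ∑ x, F0 x := sum_family_boxSum_le n M (fun _ => sq_nonneg _) V hinj
  have h1 : ∑ v ∈ V, boxSum n M F1 v.1 v.2 ≤ 4 * ∑ x, F1 x := sum_family_boxSum_le n M (fun _ => sq_nonneg _) V hinj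
  have h2 : ∑ v ∈ V, boxSum n M P v.1 v.2 ≤ 4 * ∑ x, P x := sum_family_boxSum_le n M hP0 V hinj
  have eP : ∑ x, P x = ∑ x ∈ univ.filter (blockReg n M S), ‖(LapS (fine n M) (n : ℂ) *ᵥ u) x‖ ^ 2 := by rw [hP, sum_filter]
  have e0 : ∑ x, F0 x = nsq (sdiff (fine n M) (n : ℂ) 0 *ᵥ u) := rfl
  have e1 : ∑ x, F1 x = nsq (sdiff (fine n M) (n : ℂ) 1 *ᵥ u) := rfl
  calc ∑ v ∈ V, ∑ μ, ∑ y, invW n M v (n - 1) y * ‖(sdiff (fine n M) (n : ℂ) μ *ᵥ u) y‖ ^ 2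
      ≤ ∑ v ∈ V, (c₁ * (boxSum n M F0 v.1 v.2 + boxSum n M F1 v.1 v.2) + c₂ * boxSum n M P v.1 v.2) := sum_le_sum hv
    _ = c₁ * (∑ v ∈ V, boxSum n M F0 v.1 v.2 + ∑ v ∈ V, boxSum n M F1 v.1 v.2) + c₂ * ∑ v ∈ V, boxSum n M P v.1 v.2 := by
        rw [sum_add_distrib, ← mul_sum, ← mul_sum, sum_add_distrib]
    _ ≤ c₁ * (4 * ∑ x, F0 x + 4 * ∑ x, F1 x) + c₂ * (4 * ∑ x, P x) :=
        add_le_add (mul_le_mul_of_nonneg_left (add_le_add h0 h1) hc₁0) (mul_le_mul_of_nonneg_left h2 hc₂0)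
    _ = _ := by rw [eP, e0, e1]; ring

/-- **BINDER (B), FIELD FORM, VOLUME-FREE**: `Σ_μ Σ_y ω_V(y)⁻¹|(∂_μu)(y)|² ≤ (1 + 16(1+16/(γ−1)))·E + (512π/((γ−1)ε(2−γ)))·B`. [folklore] -/
theorem weighted_energy_le_unif (V : Finset ((Fin 2 → Bool) × Tor M)) (hV : ∀ v ∈ V, ReentrantAt M S v.1 v.2)
    (hu : ∀ x, ¬ blockReg n M S x → u x = 0) (hn : 2 ≤ n) {ε : ℝ} (hε : 0 < ε) (hγ : 1 < Real.pi / 3 * (1 - ε / 2)) :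
    ∑ μ, ∑ y, (omegaV n M V (n - 1) y)⁻¹ * ‖(sdiff (fine n M) (n : ℂ) μ *ᵥ u) y‖ ^ 2
      ≤ (1 + 16 * (1 + 16 / (Real.pi / 3 * (1 - ε / 2) - 1)))
          * (nsq (sdiff (fine n M) (n : ℂ) 0 *ᵥ u) + nsq (sdiff (fine n M) (n : ℂ) 1 *ᵥ u))
        + 512 * Real.pi / ((Real.pi / 3 * (1 - ε / 2) - 1) * ε * (2 - Real.pi / 3 * (1 - ε / 2)))
          * ∑ x ∈ univ.filter (blockReg n M S), ‖(LapS (fine n M) (n : ℂ) *ᵥ u) x‖ ^ 2 := by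
  have hsplit : ∑ μ, ∑ y, (omegaV n M V (n - 1) y)⁻¹ * ‖(sdiff (fine n M) (n : ℂ) μ *ᵥ u) y‖ ^ 2
      = (nsq (sdiff (fine n M) (n : ℂ) 0 *ᵥ u) + nsq (sdiff (fine n M) (n : ℂ) 1 *ᵥ u))
        + ∑ v ∈ V, ∑ μ, ∑ y, invW n M v (n - 1) y * ‖(sdiff (fine n M) (n : ℂ) μ *ᵥ u) y‖ ^ 2 := by
    calc ∑ μ, ∑ y, (omegaV n M V (n - 1) y)⁻¹ * ‖(sdiff (fine n M) (n : ℂ) μ *ᵥ u) y‖ ^ 2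
        = ∑ μ, ∑ y, (‖(sdiff (fine n M) (n : ℂ) μ *ᵥ u) y‖ ^ 2
            + ∑ v ∈ V, invW n M v (n - 1) y * ‖(sdiff (fine n M) (n : ℂ) μ *ᵥ u) y‖ ^ 2) := by
          refine sum_congr rfl fun μ _ => sum_congr rfl fun y _ => ?_
          rw [inv_omegaV, add_mul, one_mul, sum_mul]
      _ = (∑ μ, ∑ y, ‖(sdiff (fine n M) (n : ℂ) μ *ᵥ u) y‖ ^ 2)
            + ∑ μ, ∑ y, ∑ v ∈ V, invW n M v (n - 1) y * ‖(sdiff (fine n M) (n : ℂ) μ *ᵥ u) y‖ ^ 2 := by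
          simp only [sum_add_distrib]
      _ = _ := by
          congr 1
          · rw [Fin.sum_univ_two, nsq, nsq]
          · calc ∑ μ, ∑ y, ∑ v ∈ V, invW n M v (n - 1) y * ‖(sdiff (fine n M) (n : ℂ) μ *ᵥ u) y‖ ^ 2
                = ∑ μ, ∑ v ∈ V, ∑ y, invW n M v (n - 1) y * ‖(sdiff (fine n M) (n : ℂ) μ *ᵥ u) y‖ ^ 2 :=
                  sum_congr rfl fun μ _ => sum_comm
              _ = _ := sum_comm
  rw [hsplit]
  have h := sum_vertex_energy_le n M S V hV hu hn hε hγ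
  refine (add_le_add_right h _).trans (le_of_eq ?_)
  ring

/-- **THE DYADIC HESSIANS OF ALL RE-ENTRANT VERTICES TOGETHER**: `Σ_{v∈V} Σ_μ Σ_x hessW_v|∂ᴴ∂u|² ≤ 4·(2C_J·E + C′_J·B)`. [folklore] -/
theorem sum_vertex_hessian_le (V : Finset ((Fin 2 → Bool) × Tor M)) (hV : ∀ v ∈ V, ReentrantAt M S v.1 v.2)
    (hu : ∀ x, ¬ blockReg n M S x → u x = 0) (hn : 2 ≤ n) {J : ℕ} (hJ : 20 * 2 ^ J + 1 ≤ n - 1)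
    {ε : ℝ} (hε : 0 < ε) (hγ : 1 < Real.pi / 3 * (1 - ε / 2)) :
    ∑ v ∈ V, ∑ μ, ∑ x, hessW n M v (n - 1) J x * ‖(Pdir (fine n M) (n : ℂ) μ *ᵥ u) x‖ ^ 2
      ≤ 4 * (2 * (112 + 10 ^ 9 / (Real.pi / 3 * (1 - ε / 2) - 1))
            * (nsq (sdiff (fine n M) (n : ℂ) 0 *ᵥ u) + nsq (sdiff (fine n M) (n : ℂ) 1 *ᵥ u))
          + (8 / 5 + 4 * Real.pi * (112 + 10 ^ 9 / (Real.pi / 3 * (1 - ε / 2) - 1)) / (ε * (2 - Real.pi / 3 * (1 - ε / 2))))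
            * ∑ x ∈ univ.filter (blockReg n M S), ‖(LapS (fine n M) (n : ℂ) *ᵥ u) x‖ ^ 2) := by
  have hπ3 := Real.pi_gt_three
  have hε2 : ε < 2 := by
    by_contra h
    have : Real.pi / 3 * (1 - ε / 2) ≤ 0 := mul_nonpos_of_nonneg_of_nonpos (by positivity) (by linarith)
    linarith
  have hγ1 : 0 < Real.pi / 3 * (1 - ε / 2) - 1 := by linarith
  have h2γ : 0 < 2 - Real.pi / 3 * (1 - ε / 2) := by
    have h1 : Real.pi / 3 * (1 - ε / 2) ≤ Real.pi / 3 * 1 := mul_le_mul_of_nonneg_left (by linarith) (by positivity)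
    linarith [Real.pi_lt_four]
  set c₁ : ℝ := 2 * (112 + 10 ^ 9 / (Real.pi / 3 * (1 - ε / 2) - 1)) with hc₁
  set c₂ : ℝ := 8 / 5 + 4 * Real.pi * (112 + 10 ^ 9 / (Real.pi / 3 * (1 - ε / 2) - 1)) / (ε * (2 - Real.pi / 3 * (1 - ε / 2)))
    with hc₂
  have hc₁0 : 0 ≤ c₁ := by positivity
  have hc₂0 : 0 ≤ c₂ := by positivity
  set F0 : Tor (fine n M) → ℝ := fun x => ‖(sdiff (fine n M) (n : ℂ) 0 *ᵥ u) x‖ ^ 2 with hF0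
  set F1 : Tor (fine n M) → ℝ := fun x => ‖(sdiff (fine n M) (n : ℂ) 1 *ᵥ u) x‖ ^ 2 with hF1
  set P : Tor (fine n M) → ℝ := fun x => if blockReg n M S x then ‖(LapS (fine n M) (n : ℂ) *ᵥ u) x‖ ^ 2 else 0 with hP
  have hP0 : ∀ x, 0 ≤ P x := fun x => by rw [hP]; simp only; split_ifs <;> positivity
  have hinj := reentrant_injOn M V hV
  have hv : ∀ v ∈ V, ∑ μ, ∑ x, hessW n M v (n - 1) J x * ‖(Pdir (fine n M) (n : ℂ) μ *ᵥ u) x‖ ^ 2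
      ≤ c₁ * (boxSum n M F0 v.1 v.2 + boxSum n M F1 v.1 v.2) + c₂ * boxSum n M P v.1 v.2 := by
    intro v hvV
    have hE := Et_Uc_le_box n M (σ := v.1) (b := v.2) hu (hV v hvV) (by omega)
    have hB := sqSum_Gc_le_box n M (σ := v.1) (b := v.2) (u := u) (hV v hvV) (by omega)
    have hn0 : (0 : ℝ) < n := by exact_mod_cast (show 0 < n by omega)
    have hbox0 : 0 ≤ boxSum n M F0 v.1 v.2 + boxSum n M F1 v.1 v.2 :=
      add_nonneg (sum_nonneg fun _ _ => sum_nonneg fun _ _ => sq_nonneg _) (sum_nonneg fun _ _ => sum_nonneg fun _ _ => sq_nonneg _)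
    have hboxP : 0 ≤ boxSum n M P v.1 v.2 := sum_nonneg fun _ _ => sum_nonneg fun _ _ => hP0 _
    exact vertex_weighted_hessian_le_of n M (σ := v.1) (b := v.2) hu (hV v hvV) hn hJ hε hγ hbox0 hboxP
      (by rw [le_div_iff₀ (by positivity)]; linarith) (by rw [le_div_iff₀ (by positivity)]; linarith)
  have h0 : ∑ v ∈ V, boxSum n M F0 v.1 v.2 ≤ 4 * ∑ x, F0 x := sum_family_boxSum_le n M (fun _ => sq_nonneg _) V hinj
  have h1 : ∑ v ∈ V, boxSum n M F1 v.1 v.2 ≤ 4 * ∑ x, F1 x := sum_family_boxSum_le n M (fun _ => sq_nonneg _) V hinj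
  have h2 : ∑ v ∈ V, boxSum n M P v.1 v.2 ≤ 4 * ∑ x, P x := sum_family_boxSum_le n M hP0 V hinj
  have eP : ∑ x, P x = ∑ x ∈ univ.filter (blockReg n M S), ‖(LapS (fine n M) (n : ℂ) *ᵥ u) x‖ ^ 2 := by rw [hP, sum_filter]
  have e0 : ∑ x, F0 x = nsq (sdiff (fine n M) (n : ℂ) 0 *ᵥ u) := rfl
  have e1 : ∑ x, F1 x = nsq (sdiff (fine n M) (n : ℂ) 1 *ᵥ u) := rfl
  calc ∑ v ∈ V, ∑ μ, ∑ x, hessW n M v (n - 1) J x * ‖(Pdir (fine n M) (n : ℂ) μ *ᵥ u) x‖ ^ 2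
      ≤ ∑ v ∈ V, (c₁ * (boxSum n M F0 v.1 v.2 + boxSum n M F1 v.1 v.2) + c₂ * boxSum n M P v.1 v.2) := sum_le_sum hv
    _ = c₁ * (∑ v ∈ V, boxSum n M F0 v.1 v.2 + ∑ v ∈ V, boxSum n M F1 v.1 v.2) + c₂ * ∑ v ∈ V, boxSum n M P v.1 v.2 := by
        rw [sum_add_distrib, ← mul_sum, ← mul_sum, sum_add_distrib]
    _ ≤ c₁ * (4 * ∑ x, F0 x + 4 * ∑ x, F1 x) + c₂ * (4 * ∑ x, P x) :=
        add_le_add (mul_le_mul_of_nonneg_left (add_le_add h0 h1) hc₁0) (mul_le_mul_of_nonneg_left h2 hc₂0)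
    _ = _ := by rw [eP, e0, e1]; ring

end Family

end Summit.QuantumFields.BalabanUV.Beta.GAN24.DirichletVertexLocalSums

end
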